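import Summits.QuantumFields.YangMills.Theorems.EquipartitionCriticalityEquipartitionPinsProbeEquipartition
import HarnessLib

/-!
# Route `EntropyBudgetEquipartition`, crux `EntropyBudgetTransfer` (stmt-QuantumFields-22401) — helper KT1 «budget rate by convexity»

HONEST LABEL: a helper toward a RECORD-label rung (R2ξ-G); nothing here bears on the Yang–Mills mass
gap itself.

The route's two-layer plan (Theses/EntropyBudgetEquipartition.lean, «KT1 = BUDGET RATE») asks for the
tree's qualitative `SubgradientLogSqueeze` (item 8765) / `stub_equipartition` made QUANTITATIVE: a
free-energy RATE `|f(β) + c log β − K| ≤ C β^{−κ}` (the crux `FreeEnergyRate`, K1) forces every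
subgradient-type slope `p` of the convex pressure at `β` to satisfy `|β p + c| ≤ C' β^{−κ/2}` — test the
supporting line at the two points `β(1 ± β^{−κ/2})` — and hence, by Griffiths' lemma (tree
`EquipartitionPinsProbe.Equipartition.griffiths`, `supportingLine`), the mean Wilson site energy obeys
`|β·E[s₀] − 3D/2| ≤ C' β^{−κ/2}` both for torus-limit states and, at fixed `β`, eventually along the
finite tori (`s₀ = Σ_{i<j} (N − Re tr r(U_{0,ij}))`, the six plaquettes at the origin; `D = dim 𝔤_r`).

* `subgradient_rate` — the pure real-analysis core (slack `C β^{−κ}` allowed in the two supporting-line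
  tests; constant `2|c| + (2 + 2^κ) C`);
* `budgetRate_limitStates` — `K1 ⇒ |β E_μ[s₀] − 3D/2| ≤ C' β^{−κ/2}` for `μ ∈ infiniteVolumeLimitPoints`;
* `budgetRate_torus` — `K1 ⇒` for `β ≥ β₁`, eventually in `L`,
  `|β ⟨s₀⟩_{β, L+1} − 3D/2| ≤ C' β^{−κ/2}` (torus Wilson states, the vocabulary of item 22401).

References: R. B. Griffiths, J. Math. Phys. 5 (1964) 1215 (energy densities are subgradients of the
pressure); S. Friedli, Y. Velenik, *Statistical Mechanics of Lattice Systems*, CUP 2017, Thm. 3.34 /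
§6.9; S. Chatterjee, arXiv:1602.01222 (the rate's source). [FriedliVelenik2017] [arXiv160201222]
-/

noncomputable section

namespace Summit.QuantumFields.YangMills.Theorems.EntropyBudgetEquipartition.BudgetRate

open MeasureTheory Filter Topology
open Literature.MathematicalPhysics.QuantumLattice Literature.MathematicalPhysics.QuantumFieldTheory

/-! ### Quantitative subgradient squeeze (pure real analysis) -/

/-- `x − x² ≤ log(1+x) ≤ x` for `x ≥ 0`. [folklore] -/
theorem log_one_add_bounds {x : ℝ} (hx0 : 0 ≤ x) :
    x - x ^ 2 ≤ Real.log (1 + x) ∧ Real.log (1 + x) ≤ x := by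
  have h1 : 0 < 1 + x := by linarith
  constructor
  · have h := Real.one_sub_inv_le_log_of_pos h1
    have hinv : 1 - (1 + x)⁻¹ = x / (1 + x) := by field_simp; ring
    rw [hinv] at h
    refine le_trans ?_ h
    rw [le_div_iff₀ h1]
    nlinarith [sq_nonneg x, mul_nonneg hx0 (sq_nonneg x)]
  · have := Real.log_le_sub_one_of_pos h1; linarith

/-- `−x − 2x² ≤ log(1−x) ≤ −x` for `x ≤ 1/2`. [folklore] -/
theorem log_one_sub_bounds {x : ℝ} (hx : x ≤ 1 / 2) :
    -x - 2 * x ^ 2 ≤ Real.log (1 - x) ∧ Real.log (1 - x) ≤ -x := by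
  have h1 : 0 < 1 - x := by linarith
  constructor
  · have h := Real.one_sub_inv_le_log_of_pos h1
    have hinv : 1 - (1 - x)⁻¹ = -(x / (1 - x)) := by field_simp; ring
    rw [hinv] at h
    have hq : x / (1 - x) ≤ x + 2 * x ^ 2 := by
      rw [div_le_iff₀ h1]
      nlinarith [mul_nonneg (sq_nonneg x) (by linarith : (0 : ℝ) ≤ 1 - 2 * x)]
    linarith
  · have := Real.log_le_sub_one_of_pos h1; linarith

/-- **Quantitative subgradient squeeze.** If `|f(β) + c log β − K| ≤ C β^{−κ}` for `β ≥ β₀` (`κ > 0`,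
`C ≥ 0`), then for all large `β` every slope `p` passing the two supporting-line tests at
`β(1 ± β^{−κ/2})` up to slack `C β^{−κ}` satisfies `|β p + c| ≤ (2|c| + (2 + 2^κ) C) β^{−κ/2}`.
(The qualitative version is the tree's `subgradientLogSqueeze_proof`.) [cite: FriedliVelenik2017, Thm. 3.34] -/
theorem subgradient_rate {f : ℝ → ℝ} {c K C κ β₀ : ℝ} (hκ : 0 < κ) (hC : 0 ≤ C)
    (hrate : ∀ β : ℝ, β₀ ≤ β → |f β + c * Real.log β - K| ≤ C * β ^ (-κ)) :
    ∃ β₁ : ℝ, 0 < β₁ ∧ ∀ β : ℝ, β₁ ≤ β → ∀ p : ℝ,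
      f β + p * (β * β ^ (-(κ / 2))) ≤ f (β + β * β ^ (-(κ / 2))) + C * β ^ (-κ) →
      f β - p * (β * β ^ (-(κ / 2))) ≤ f (β - β * β ^ (-(κ / 2))) + C * β ^ (-κ) →
      |β * p + c| ≤ (2 * |c| + (2 + (2 : ℝ) ^ κ) * C) * β ^ (-(κ / 2)) := by
  refine ⟨max (max (2 * |β₀|) 2) ((2 : ℝ) ^ (2 / κ)), lt_of_lt_of_le two_pos
    ((le_max_right _ _).trans (le_max_left _ _)), fun β hβ p hup hdn => ?_⟩
  have hβ2 : 2 ≤ β := (le_max_right _ _).trans ((le_max_left _ _).trans hβ)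
  have hβa : 2 * |β₀| ≤ β := (le_max_left _ _).trans ((le_max_left _ _).trans hβ)
  have hβp : (2 : ℝ) ^ (2 / κ) ≤ β := (le_max_right _ _).trans hβ
  have hβ0 : 0 < β := by linarith
  have hβ₀ : β₀ ≤ β / 2 := by have := le_abs_self β₀; linarith
  -- the step `x = β^{-κ/2} ∈ (0, 1/2]`
  set x : ℝ := β ^ (-(κ / 2)) with hx
  have hx0 : 0 < x := Real.rpow_pos_of_pos hβ0 _
  have hx2 : x ≤ 1 / 2 := by
    have h2p : (0 : ℝ) < (2 : ℝ) ^ (2 / κ) := Real.rpow_pos_of_pos two_pos _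
    calc x ≤ ((2 : ℝ) ^ (2 / κ)) ^ (-(κ / 2)) :=
          Real.rpow_le_rpow_of_nonpos h2p hβp (by linarith)
      _ = (2 : ℝ) ^ ((2 / κ) * (-(κ / 2))) := by rw [← Real.rpow_mul zero_le_two]
      _ = (2 : ℝ) ^ (-(1 : ℝ)) := by congr 1; field_simp
      _ = 1 / 2 := by rw [Real.rpow_neg_one]; norm_num
  have hxx : β ^ (-κ) = x * x := by
    rw [hx, ← Real.rpow_add hβ0]; congr 1; ring
  have hκ1 : (1 : ℝ) ≤ (2 : ℝ) ^ κ := Real.one_le_rpow one_le_two hκ.le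
  -- the two test points
  have hplus : β + β * x = β * (1 + x) := by ring
  have hminus : β - β * x = β * (1 - x) := by ring
  have h1p : 0 < 1 + x := by linarith
  have h1m : 0 < 1 - x := by linarith
  have hβx : 0 < β * x := mul_pos hβ0 hx0
  have hβx2 : β * x ≤ β * (1 / 2) := mul_le_mul_of_nonneg_left hx2 hβ0.le
  have hyp : β ≤ β * (1 + x) := by linarith
  have hym : β / 2 ≤ β * (1 - x) := by linarith
  have hym0 : 0 < β * (1 - x) := by linarith
  -- the rate at the three points
  have r0 := abs_le.1 (hrate β (by linarith))
  have rp := (abs_le.1 (hrate (β * (1 + x)) (by linarith))).2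
  have rm := (abs_le.1 (hrate (β * (1 - x)) (by linarith))).2
  rw [Real.log_mul hβ0.ne' h1p.ne'] at rp
  rw [Real.log_mul hβ0.ne' h1m.ne'] at rm
  have hpowp : (β * (1 + x)) ^ (-κ) ≤ β ^ (-κ) :=
    Real.rpow_le_rpow_of_nonpos hβ0 hyp (by linarith)
  have hpowm : (β * (1 - x)) ^ (-κ) ≤ (2 : ℝ) ^ κ * β ^ (-κ) := by
    have h1 : (β * (1 - x)) ^ (-κ) ≤ (β / 2) ^ (-κ) :=
      Real.rpow_le_rpow_of_nonpos (by positivity) hym (by linarith)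
    have h2 : (β / 2) ^ (-κ) = (2 : ℝ) ^ κ * β ^ (-κ) := by
      rw [Real.div_rpow hβ0.le zero_le_two, Real.rpow_neg zero_le_two, div_inv_eq_mul, mul_comm]
    rw [← h2]; exact h1
  have hCp := mul_le_mul_of_nonneg_left hpowp hC
  have hCm := mul_le_mul_of_nonneg_left hpowm hC
  -- the logarithms
  obtain ⟨lp1, lp2⟩ := log_one_add_bounds hx0.le
  obtain ⟨lm1, lm2⟩ := log_one_sub_bounds hx2
  have tp : c * (x - Real.log (1 + x)) ≤ |c| * x ^ 2 := by
    have h0 : 0 ≤ x - Real.log (1 + x) := by linarith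
    calc c * (x - Real.log (1 + x)) ≤ |c| * (x - Real.log (1 + x)) :=
          mul_le_mul_of_nonneg_right (le_abs_self c) h0
      _ ≤ |c| * x ^ 2 := mul_le_mul_of_nonneg_left (by linarith) (abs_nonneg c)
  have tm : c * (-x - Real.log (1 - x)) ≤ |c| * (2 * x ^ 2) := by
    have h0 : 0 ≤ -x - Real.log (1 - x) := by linarith
    calc c * (-x - Real.log (1 - x)) ≤ |c| * (-x - Real.log (1 - x)) :=
          mul_le_mul_of_nonneg_right (le_abs_self c) h0
      _ ≤ |c| * (2 * x ^ 2) := mul_le_mul_of_nonneg_left (by linarith) (abs_nonneg c)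
  rw [hplus] at hup
  rw [hminus] at hdn
  -- upper: `p β x ≤ -c x + (|c| + 3C) x²`
  rw [hxx] at r0 hCp hCm hup hdn
  have hU : p * β * x ≤ -c * x + (|c| + 3 * C) * x ^ 2 := by
    linarith [r0.1, rp, hCp, hup, tp]
  -- lower: `-p β x ≤ c x + (2|c| + (2 + 2^κ) C) x²`
  have hL : -(p * β * x) ≤ c * x + (2 * |c| + (2 + (2 : ℝ) ^ κ) * C) * x ^ 2 := by
    linarith [r0.1, rm, hCm, hdn, tm]
  -- divide by `x > 0`
  have hU' : β * p ≤ -c + (|c| + 3 * C) * x := by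
    have : (β * p) * x ≤ (-c + (|c| + 3 * C) * x) * x := by linarith [hU]
    exact le_of_mul_le_mul_right this hx0
  have hL' : -(β * p) ≤ c + (2 * |c| + (2 + (2 : ℝ) ^ κ) * C) * x := by
    have : (-(β * p)) * x ≤ (c + (2 * |c| + (2 + (2 : ℝ) ^ κ) * C) * x) * x := by linarith [hL]
    exact le_of_mul_le_mul_right this hx0
  have h3 : 0 ≤ |c| * x := mul_nonneg (abs_nonneg c) hx0.le
  have h4 : 0 ≤ C * x * ((2 : ℝ) ^ κ - 1) := mul_nonneg (mul_nonneg hC hx0.le) (by linarith)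
  rw [abs_le]
  constructor <;> linarith

/-! ### KT1 for torus-limit states -/

variable {G : Type} [Group G] [TopologicalSpace G] [IsTopologicalGroup G] [CompactSpace G]
  [MeasurableSpace G] [BorelSpace G]

/-- **KT1 (budget rate), torus-limit states.** A free-energy rate
`|f_r(β) + (3D/2) log β − K| ≤ C β^{−κ}` (`β ≥ β₀`; the body of the crux `FreeEnergyRate`) forces
`|β · E_μ[s₀] − 3D/2| ≤ C' β^{−κ/2}` for all large `β` and every torus-limit state
`μ ∈ infiniteVolumeLimitPoints r.ρ β` (`s₀` the Wilson energy of the six plaquettes at the origin):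
Griffiths' lemma (`Equipartition.griffiths`: `−E_μ[s₀]` is a subgradient of the pressure at `β`) and
`subgradient_rate`. [cite: FriedliVelenik2017, Thm. 3.34] -/
theorem budgetRate_limitStates (r : LatticeRep G) {D : ℕ} {K κ C β₀ : ℝ} (hκ : 0 < κ)
    (hrate : ∀ β : ℝ, β₀ ≤ β →
      |freeEnergyDensity 4 r.ρ β + (3 * (D : ℝ) / 2) * Real.log β - K| ≤ C * β ^ (-κ)) :
    ∃ C' β₁ : ℝ, ∀ β : ℝ, β₁ ≤ β → ∀ μ ∈ infiniteVolumeLimitPoints (d := 4) r.ρ β,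
      |β * (∫ U, (∑ i : Fin 4, ∑ j : Fin 4,
          if i < j then ((r.N : ℝ) - plaquetteObs r.ρ 0 i j U) else 0) ∂μ) - 3 * (D : ℝ) / 2| ≤
        C' * β ^ (-(κ / 2)) := by
  haveI : SecondCountableTopology (Matrix (Fin r.N) (Fin r.N) ℂ) :=
    inferInstanceAs (SecondCountableTopology (Fin r.N → Fin r.N → ℂ))
  haveI : SecondCountableTopology G :=
    (r.continuous.isClosedEmbedding r.injective).isEmbedding.secondCountableTopology
  -- the rate with a non-negative constant, on `β ≥ max β₀ 0`
  set Cp : ℝ := max C 0 with hCp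
  have hCp0 : 0 ≤ Cp := le_max_right _ _
  have hrate' : ∀ β : ℝ, max β₀ 0 ≤ β →
      |freeEnergyDensity 4 r.ρ β + (3 * (D : ℝ) / 2) * Real.log β - K| ≤ Cp * β ^ (-κ) := by
    intro β hβ
    have hβ0 : 0 ≤ β := (le_max_right _ _).trans hβ
    exact (hrate β ((le_max_left _ _).trans hβ)).trans
      (mul_le_mul_of_nonneg_right (le_max_left _ _) (Real.rpow_nonneg hβ0 _))
  obtain ⟨β₁, hβ₁0, hcore⟩ := subgradient_rate (f := freeEnergyDensity 4 r.ρ) hκ hCp0 hrate'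
  refine ⟨2 * |3 * (D : ℝ) / 2| + (2 + (2 : ℝ) ^ κ) * Cp, β₁, fun β hβ μ hμ => ?_⟩
  have hβ0 : 0 < β := lt_of_lt_of_le hβ₁0 hβ
  set e : ℝ := ∫ U, (∑ i : Fin 4, ∑ j : Fin 4,
    if i < j then ((r.N : ℝ) - plaquetteObs r.ρ 0 i j U) else 0) ∂μ with he
  have hsub := fun y => EquipartitionPinsProbe.Equipartition.griffiths (d := 4) r.ρ r.continuous hμ y
  have hslack : 0 ≤ Cp * β ^ (-κ) := mul_nonneg hCp0 (Real.rpow_nonneg hβ0.le _)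
  have h := hcore β hβ (-e)
    (by have := hsub (β + β * β ^ (-(κ / 2))); rw [← he] at this; nlinarith)
    (by have := hsub (β - β * β ^ (-(κ / 2))); rw [← he] at this; nlinarith)
  rw [show β * -e + 3 * (D : ℝ) / 2 = -(β * e - 3 * (D : ℝ) / 2) by ring, abs_neg] at h
  exact h

/-! ### KT1 on finite tori -/

/-- **KT1 (budget rate), finite tori.** A free-energy rate
`|f_r(β) + (3D/2) log β − K| ≤ C β^{−κ}` (`β ≥ β₀`) forces, for all large `β` and then eventually
along the tori `Λ_{L+1}`, `|β · ⟨s₀⟩_{β, L+1} − 3D/2| ≤ C' β^{−κ/2}`: the Gibbs–Jensen supporting line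
on the torus (`Equipartition.supportingLine`) tested at `β(1 ± β^{−κ/2})`, the convergence of the
torus pressures at these three couplings (`exists_hasFreeEnergyDensity_holds`) supplying the slack,
and `subgradient_rate`. [cite: FriedliVelenik2017, Thm. 3.34] -/
theorem budgetRate_torus (r : LatticeRep G) {D : ℕ} {K κ C β₀ : ℝ} (hκ : 0 < κ)
    (hrate : ∀ β : ℝ, β₀ ≤ β →
      |freeEnergyDensity 4 r.ρ β + (3 * (D : ℝ) / 2) * Real.log β - K| ≤ C * β ^ (-κ)) :
    ∃ C' β₁ : ℝ, ∀ β : ℝ, β₁ ≤ β → ∀ᶠ L : ℕ in atTop,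
      |β * wilsonExpectation (L := L + 1) r.ρ β (toTorusObservable (L + 1)
          fun U : LGConfig 4 G => ∑ i : Fin 4, ∑ j : Fin 4,
            if i < j then ((r.N : ℝ) - plaquetteObs r.ρ 0 i j U) else 0) - 3 * (D : ℝ) / 2| ≤
        C' * β ^ (-(κ / 2)) := by
  haveI : SecondCountableTopology (Matrix (Fin r.N) (Fin r.N) ℂ) :=
    inferInstanceAs (SecondCountableTopology (Fin r.N → Fin r.N → ℂ))
  haveI : SecondCountableTopology G :=
    (r.continuous.isClosedEmbedding r.injective).isEmbedding.secondCountableTopology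
  -- the rate with the constant `max C 0 + 1`, on `β ≥ max β₀ 0`
  set Cp : ℝ := max C 0 + 1 with hCp
  have hCp0 : 0 ≤ Cp := by have := le_max_right C 0; linarith
  have hrate' : ∀ β : ℝ, max β₀ 0 ≤ β →
      |freeEnergyDensity 4 r.ρ β + (3 * (D : ℝ) / 2) * Real.log β - K| ≤ Cp * β ^ (-κ) := by
    intro β hβ
    have hβ0 : 0 ≤ β := (le_max_right _ _).trans hβ
    exact (hrate β ((le_max_left _ _).trans hβ)).trans
      (mul_le_mul_of_nonneg_right (by have := le_max_left C 0; linarith) (Real.rpow_nonneg hβ0 _))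
  obtain ⟨β₁, hβ₁0, hcore⟩ := subgradient_rate (f := freeEnergyDensity 4 r.ρ) hκ hCp0 hrate'
  refine ⟨2 * |3 * (D : ℝ) / 2| + (2 + (2 : ℝ) ^ κ) * Cp, max β₁ (max β₀ 0), fun β hβ => ?_⟩
  have hβ1 : β₁ ≤ β := (le_max_left _ _).trans hβ
  have hβ0 : 0 < β := lt_of_lt_of_le hβ₁0 hβ1
  set f : ℝ → ℝ := freeEnergyDensity 4 r.ρ with hf
  set x : ℝ := β ^ (-(κ / 2)) with hx
  set fL : ℝ → ℕ → ℝ := fun y L => (((L + 1 : ℕ) : ℝ) ^ 4)⁻¹ * torusLogPartition 4 r.ρ y (L + 1)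
    with hfL
  have hconv : ∀ y : ℝ, Tendsto (fL y) atTop (𝓝 (f y)) := fun y =>
    hasFreeEnergyDensity_freeEnergyDensity r.ρ (exists_hasFreeEnergyDensity_holds (d := 4) r.ρ r.continuous y)
  -- slack `η = β^{-κ}/2` at the three couplings, eventually in `L`
  set η : ℝ := β ^ (-κ) / 2 with hη
  have hη0 : 0 < η := by rw [hη]; exact half_pos (Real.rpow_pos_of_pos hβ0 _)
  have evp : ∀ᶠ L : ℕ in atTop, fL (β + β * x) L ≤ f (β + β * x) + η :=
    (hconv _).eventually (ge_mem_nhds (by linarith))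
  have evm : ∀ᶠ L : ℕ in atTop, fL (β - β * x) L ≤ f (β - β * x) + η :=
    (hconv _).eventually (ge_mem_nhds (by linarith))
  have ev0 : ∀ᶠ L : ℕ in atTop, f β - η ≤ fL β L :=
    (hconv _).eventually (le_mem_nhds (by linarith))
  filter_upwards [evp, evm, ev0] with L hp hm h0
  set e : ℝ := wilsonExpectation (L := L + 1) r.ρ β (toTorusObservable (L + 1)
    fun U : LGConfig 4 G => ∑ i : Fin 4, ∑ j : Fin 4,
      if i < j then ((r.N : ℝ) - plaquetteObs r.ρ 0 i j U) else 0) with he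
  have hsl := fun y => EquipartitionPinsProbe.Equipartition.supportingLine (d := 4) r.ρ r.continuous β y (L + 1)
  have hslp := hsl (β + β * x)
  have hslm := hsl (β - β * x)
  rw [← he] at hslp hslm
  have hC1 : β ^ (-κ) ≤ Cp * β ^ (-κ) := by
    have hp : 0 ≤ β ^ (-κ) := Real.rpow_nonneg hβ0.le _
    have : (1 : ℝ) ≤ Cp := by have := le_max_right C 0; rw [hCp]; linarith
    nlinarith
  have hfLp : fL (β + β * x) L = (((L + 1 : ℕ) : ℝ) ^ 4)⁻¹ * torusLogPartition 4 r.ρ (β + β * x) (L + 1) := rfl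
  have hfLm : fL (β - β * x) L = (((L + 1 : ℕ) : ℝ) ^ 4)⁻¹ * torusLogPartition 4 r.ρ (β - β * x) (L + 1) := rfl
  have hfL0 : fL β L = (((L + 1 : ℕ) : ℝ) ^ 4)⁻¹ * torusLogPartition 4 r.ρ β (L + 1) := rfl
  rw [← hfLp, ← hfL0] at hslp
  rw [← hfLm, ← hfL0] at hslm
  have h := hcore β hβ1 (-e) (by rw [hη] at hp h0; nlinarith) (by rw [hη] at hm h0; nlinarith)
  rw [show β * -e + 3 * (D : ℝ) / 2 = -(β * e - 3 * (D : ℝ) / 2) by ring, abs_neg] at h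
  exact h

end Summit.QuantumFields.YangMills.Theorems.EntropyBudgetEquipartition.BudgetRate

end
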